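import Summits.QuantumFields.YangMills.Theorems.UnitScaleTiltProp7SectET3WChartConjT3
import HarnessLib

/-!
# Route `UnitScaleTilt`, crux «MinimiserStabilityRegPr» (stmt-QuantumFields-19200, stub EX `stub_existenceMinimalOrbit`, route (α)) — «HCHART-CONT»: **THE CHART IDENTITY ALONG THE RAY,
# EVENTUALLY IN `t`** — the row `hchart : ∀ᶠ t in 𝓝 0, κ_f • ι(Tc (A′ + tδ′)) = χ(κ_f • ιA′ + t•δ)` of the assembly ✓`Prop7Crit93AtMemberOfRow84.deriv_chartRay_eq_zero_of_eq111_of_hasDerivAt_actionZ`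
# from a POINTWISE chart conjugacy on strict norm windows (✓`Prop7SectET3WChartConj.smul_iota_T47_eq_chart`, ym3-torus-px14 (G22)) + continuity of the ray

Cell `ym3-torus` (HUMAN RULING D-0037, YM ladder rung R3 — YM₃ on T³, NOT d = 4, NOT Clay; YM gap NOT proved), width seat `ym3-torus-px21` gen 2 (explicit-unit helper; lineage `hCrit93′`);
EX namer ★`ym-ust-19200-w2` g6 word 2026-08-28T20:48:46Z «px21: H74-MEMBER + HCHART-CONT GO».  THEOREMS ONLY (0 `def`, 0 `sorry`); `--supports stmt-QuantumFields-19200 --as helper`, count-neutral;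
NO claim on crux ∕ stub ∕ registry.

THE PRINT.  [Balaban1985Variational] (47)–(49) p. 285 (the chart `A = A′ − HD(A′)`), (82)–(84) p. 290 (the ray `A′ + tδA′` inside the space (75)–(77), an OPEN condition), (112) p. 294.  The
assembly differentiates `t ↦ A(U₁(A′ + tδ′))` at `t = 0`; lit `B11Eq81ExpansionZpow.hasDerivAt_actionZ_chartRay_real` writes the chart as `T47 H̃ C̃ εC`, the EX display as `χ X = X − H(Dfix … X)`;
(G22) identifies them POINTWISE on the windows `‖A″‖ < a_C`, `‖A″‖ < ε′`, `‖κ_f • ιA″‖ < ε`; since the windows are strict and the ray is continuous, the identity holds for all small `|t|`.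

WHAT IS PROVED (member `F`, `K n`; `U₀ : GaugeField (F.P K) 0 SU(2)`; `κ_f := (η:ℂ)·I`, `ιA″ := (JetSup.equiv A″) ∘ bondEquiv`; ns `…Theorems.Prop7ChartRayContinuity`):
* §1 `iota_add_smul` (`ι(A₁ + Z + tδ′) = ιA₁ + ιZ + t•ιδ′`, by `rfl`), `smul_iota_ray` (`κ_f • ι(A₁ + Z + tδ′) = κ_f • (ιA₁ + ιZ) + t•(κ_f • ιδ′)`), ★`eventually_windows` (the three strict windows
  persist along the ray near `t = 0`).
* §2 ★★★ **`eventually_chart_eq_of_pointwise`** — GENERIC: for ANY chart maps `Tc` (A-units) and `χ` (exponent units) with the pointwise conjugacy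
  `hG : ∀ A″, ‖A″‖ < a_C → ‖A″‖ < ε′ → ‖κ_f • ιA″‖ < ε → κ_f • ι(Tc A″) = χ(κ_f • ιA″)` and strict windows at `A′ = A₁ + Z`:
  `∀ᶠ t in 𝓝 0, κ_f • ι(Tc (A₁ + Z + (t:ℂ)•δ′)) = χ(κ_f • (ιA₁ + ιZ) + (t:ℂ)•(κ_f • ιδ′))` — the assembly's `hchart` with `δ := κ_f • ιδ′` (any `H`-letter: `H46` today, `H46ᴾ` after the
  PINV cascade, ★★OWNER RULING g28-№4).
* §3 ★★ **`eventually_smul_iota_T47_eq_chart`** — THE INSTANCE OF RECORD TODAY: (G22) ✓`smul_iota_T47_eq_chart` (chart `T47 H̃ C̃ εC`, `H̃ := H1f …Δ_π… U₀`, `C̃ := (−I)•CmapTwS U₀ (κ_f • ι·)`,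
  `χ X := X − H46 U₀ (Dfix (CmapTwS U₀) (H46 U₀) C₂ X)`) under its displayed regime rows, made eventual along the ray.
HONEST SCOPE.  Elementary topology (continuity of an affine ray in finite dimensions) over landed letters; the regime rows of (G22) stay displayed; no estimate; not a proof of any stub;
nothing continuum ∕ OS ∕ mass-gap ∕ Clay.

References: T. Bałaban, CMP **102** (1985) 277–309 [Balaban1985Variational] ((47)–(49) p.285, (75)–(77) p.289, (82)–(84) p.290, (112) p.294).
-/

set_option autoImplicit false

noncomputable section

open scoped Matrix.Norms.L2Operator Topology
open Filter Topology

namespace Summit.QuantumFields.YangMills.Theorems.Prop7ChartRayContinuity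

open Literature.MathematicalPhysics.QuantumFieldTheory.Balaban1983to89
open Literature.MathematicalPhysics.QuantumFieldTheory.Balaban1983to89.T3ContinuumYM3Torus
open T3SectALandauChart (eta eta_pos)
open B9SectCLatticeCarrier (Bond)
open B11Eq115Space (NegSup NegSize Space115 JetSup)
open B11Eq111FrakG (nabla115)
open B13Contraction113 (QuadAnalytic)
open B11Eq174Chart (Regime)
open B11Eq90V0GroupComposed (T47)
open B11Prop3Model (Dfix)
open Summit.QuantumFields.YangMills.Theorems.Prop7SectET3Transport (periodsT3 bondEquiv bgOfCfg)
open Summit.QuantumFields.YangMills.Theorems.Prop7SymAvgTwSym (CmapTwS)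
open Summit.QuantumFields.YangMills.Theorems.Prop7SectET3CurvedPropagators (H1f)
open Summit.QuantumFields.YangMills.Theorems.Prop7SectET3DeltaPi (DeltaPiSlot H46)
open Summit.QuantumFields.YangMills.Theorems.Prop7SectET3WChartConj (smul_iota_T47_eq_chart)

variable {F : T3Family} {n K : ℕ} [Fact (0 < (F.L : ℝ))] [Fact (0 < ((F.L : ℝ)⁻¹) ^ (K - n))]

/-! ## §1 The ray in the 0-jet reading, and persistence of the strict windows -/

omit [Fact (0 < (F.L : ℝ))] [Fact (0 < ((F.L : ℝ)⁻¹) ^ (K - n))] in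
/-- `ι(A₁ + Z + t•δ′) = ιA₁ + ιZ + t•ιδ′` (the 0-jet reading is linear; `rfl`). [cite: Balaban1985Variational, (115) p.294] -/
theorem iota_add_smul (U₀ : GaugeField (F.P K) 0 (Matrix.specialUnitaryGroup (Fin 2) ℂ))
    (A₁ Z δ' : Space115 (F.L : ℝ) (((F.L : ℝ)⁻¹) ^ (K - n)) (fun _ : Bond 3 (periodsT3 F K) => K - n) (fun _ : Bond 3 (periodsT3 F K) × Fin 3 => K - n)
      (nabla115 (((F.L : ℝ)⁻¹) ^ (K - n)) (bgOfCfg F K U₀))) (t : ℝ) :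
    (fun b : PBond (F.P K) 0 => JetSup.equiv _ _ _ (A₁ + Z + (t : ℂ) • δ') (bondEquiv F K b))
      = (fun b : PBond (F.P K) 0 => JetSup.equiv _ _ _ A₁ (bondEquiv F K b)) + (fun b : PBond (F.P K) 0 => JetSup.equiv _ _ _ Z (bondEquiv F K b))
          + (t : ℂ) • (fun b : PBond (F.P K) 0 => JetSup.equiv _ _ _ δ' (bondEquiv F K b)) := rfl

omit [Fact (0 < (F.L : ℝ))] [Fact (0 < ((F.L : ℝ)⁻¹) ^ (K - n))] in
/-- `κ_f • ι(A₁ + Z + t•δ′) = κ_f • (ιA₁ + ιZ) + t•(κ_f • ιδ′)` — the exponent reading of the ray is the assembly's `X + t•δ` with `δ := κ_f • ιδ′`. [cite: Balaban1985Variational, (82) p.290, (112) p.294] -/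
theorem smul_iota_ray (U₀ : GaugeField (F.P K) 0 (Matrix.specialUnitaryGroup (Fin 2) ℂ))
    (A₁ Z δ' : Space115 (F.L : ℝ) (((F.L : ℝ)⁻¹) ^ (K - n)) (fun _ : Bond 3 (periodsT3 F K) => K - n) (fun _ : Bond 3 (periodsT3 F K) × Fin 3 => K - n)
      (nabla115 (((F.L : ℝ)⁻¹) ^ (K - n)) (bgOfCfg F K U₀))) (t : ℝ) :
    ((((eta F n K : ℝ) : ℂ)) * Complex.I) • (fun b : PBond (F.P K) 0 => JetSup.equiv _ _ _ (A₁ + Z + (t : ℂ) • δ') (bondEquiv F K b))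
      = ((((eta F n K : ℝ) : ℂ)) * Complex.I) • ((fun b : PBond (F.P K) 0 => JetSup.equiv _ _ _ A₁ (bondEquiv F K b))
            + (fun b : PBond (F.P K) 0 => JetSup.equiv _ _ _ Z (bondEquiv F K b)))
          + (t : ℂ) • (((((eta F n K : ℝ) : ℂ)) * Complex.I) • fun b : PBond (F.P K) 0 => JetSup.equiv _ _ _ δ' (bondEquiv F K b)) := by
  rw [iota_add_smul, smul_add, smul_comm]

/-- ★ **THE STRICT WINDOWS PERSIST ALONG THE RAY**: if `‖A₁ + Z‖ < a_C`, `‖A₁ + Z‖ < ε′`, `‖κ_f • ι(A₁ + Z)‖ < ε`, then for all `t` near `0` the same holds at `A₁ + Z + t•δ′` (the space (75)–(77) is open;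
continuity of the affine ray). [cite: Balaban1985Variational, (75)–(77) p.289, (82) p.290] -/
theorem eventually_windows (U₀ : GaugeField (F.P K) 0 (Matrix.specialUnitaryGroup (Fin 2) ℂ)) {aC ε' ε : ℝ}
    (A₁ Z δ' : Space115 (F.L : ℝ) (((F.L : ℝ)⁻¹) ^ (K - n)) (fun _ : Bond 3 (periodsT3 F K) => K - n) (fun _ : Bond 3 (periodsT3 F K) × Fin 3 => K - n)
      (nabla115 (((F.L : ℝ)⁻¹) ^ (K - n)) (bgOfCfg F K U₀)))
    (hA'C : ‖A₁ + Z‖ < aC) (hA' : ‖A₁ + Z‖ < ε')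
    (hA : ‖((((eta F n K : ℝ) : ℂ)) * Complex.I) • ((fun b : PBond (F.P K) 0 => JetSup.equiv _ _ _ A₁ (bondEquiv F K b))
            + (fun b : PBond (F.P K) 0 => JetSup.equiv _ _ _ Z (bondEquiv F K b)))‖ < ε) :
    ∀ᶠ t : ℝ in 𝓝 0, ‖A₁ + Z + (t : ℂ) • δ'‖ < aC ∧ ‖A₁ + Z + (t : ℂ) • δ'‖ < ε'
      ∧ ‖((((eta F n K : ℝ) : ℂ)) * Complex.I) • (fun b : PBond (F.P K) 0 => JetSup.equiv _ _ _ (A₁ + Z + (t : ℂ) • δ') (bondEquiv F K b))‖ < ε := by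
  have hc1 : Continuous fun t : ℝ => A₁ + Z + (t : ℂ) • δ' := continuous_const.add (Complex.continuous_ofReal.smul continuous_const)
  have hc2 : Continuous fun t : ℝ => ((((eta F n K : ℝ) : ℂ)) * Complex.I) • ((fun b : PBond (F.P K) 0 => JetSup.equiv _ _ _ A₁ (bondEquiv F K b))
            + (fun b : PBond (F.P K) 0 => JetSup.equiv _ _ _ Z (bondEquiv F K b)))
          + (t : ℂ) • (((((eta F n K : ℝ) : ℂ)) * Complex.I) • fun b : PBond (F.P K) 0 => JetSup.equiv _ _ _ δ' (bondEquiv F K b)) :=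
    continuous_const.add (Complex.continuous_ofReal.smul continuous_const)
  have h1 : ∀ᶠ t : ℝ in 𝓝 0, ‖A₁ + Z + (t : ℂ) • δ'‖ < aC :=
    (hc1.norm.continuousAt (x := (0 : ℝ))).eventually_lt continuousAt_const (by simpa only [Complex.ofReal_zero, zero_smul, add_zero] using hA'C)
  have h2 : ∀ᶠ t : ℝ in 𝓝 0, ‖A₁ + Z + (t : ℂ) • δ'‖ < ε' :=
    (hc1.norm.continuousAt (x := (0 : ℝ))).eventually_lt continuousAt_const (by simpa only [Complex.ofReal_zero, zero_smul, add_zero] using hA')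
  have h3 : ∀ᶠ t : ℝ in 𝓝 0, ‖((((eta F n K : ℝ) : ℂ)) * Complex.I) • ((fun b : PBond (F.P K) 0 => JetSup.equiv _ _ _ A₁ (bondEquiv F K b))
            + (fun b : PBond (F.P K) 0 => JetSup.equiv _ _ _ Z (bondEquiv F K b)))
          + (t : ℂ) • (((((eta F n K : ℝ) : ℂ)) * Complex.I) • fun b : PBond (F.P K) 0 => JetSup.equiv _ _ _ δ' (bondEquiv F K b))‖ < ε :=
    (hc2.norm.continuousAt (x := (0 : ℝ))).eventually_lt continuousAt_const (by simpa only [Complex.ofReal_zero, zero_smul, add_zero] using hA)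
  filter_upwards [h1, h2, h3] with t ht1 ht2 ht3
  exact ⟨ht1, ht2, by rwa [smul_iota_ray]⟩

/-! ## §2 ★★★ The eventual chart identity from a pointwise conjugacy on the windows — generic chart letters -/

/-- ★★★ **`hchart` FROM A POINTWISE CONJUGACY, GENERIC**: for any A-units chart `Tc` and exponent-units chart `χ` conjugate under `κ_f • ι` on the strict windows (`hG`; today: (G22)
✓`smul_iota_T47_eq_chart` with `χ X = X − H46 U₀ (Dfix … X)`; after the PINV cascade the same with `H46ᴾ`), and a base point `A₁ + Z` inside the windows, the assembly's row holds:
`∀ᶠ t in 𝓝 0, κ_f • ι(Tc (A₁ + Z + t•δ′)) = χ(κ_f • (ιA₁ + ιZ) + t•(κ_f • ιδ′))`. [cite: Balaban1985Variational, (47) p.285, (82)–(84) p.290, (112) p.294] -/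
theorem eventually_chart_eq_of_pointwise (U₀ : GaugeField (F.P K) 0 (Matrix.specialUnitaryGroup (Fin 2) ℂ)) {aC ε' ε : ℝ}
    {Tc : Space115 (F.L : ℝ) (((F.L : ℝ)⁻¹) ^ (K - n)) (fun _ : Bond 3 (periodsT3 F K) => K - n) (fun _ : Bond 3 (periodsT3 F K) × Fin 3 => K - n)
        (nabla115 (((F.L : ℝ)⁻¹) ^ (K - n)) (bgOfCfg F K U₀)) →
      Space115 (F.L : ℝ) (((F.L : ℝ)⁻¹) ^ (K - n)) (fun _ : Bond 3 (periodsT3 F K) => K - n) (fun _ : Bond 3 (periodsT3 F K) × Fin 3 => K - n)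
        (nabla115 (((F.L : ℝ)⁻¹) ^ (K - n)) (bgOfCfg F K U₀))}
    {χ : (PBond (F.P K) 0 → Matrix (Fin 2) (Fin 2) ℂ) → (PBond (F.P K) 0 → Matrix (Fin 2) (Fin 2) ℂ)}
    (hG : ∀ A'' : Space115 (F.L : ℝ) (((F.L : ℝ)⁻¹) ^ (K - n)) (fun _ : Bond 3 (periodsT3 F K) => K - n) (fun _ : Bond 3 (periodsT3 F K) × Fin 3 => K - n)
        (nabla115 (((F.L : ℝ)⁻¹) ^ (K - n)) (bgOfCfg F K U₀)),
      ‖A''‖ < aC → ‖A''‖ < ε' → ‖((((eta F n K : ℝ) : ℂ)) * Complex.I) • (fun b : PBond (F.P K) 0 => JetSup.equiv _ _ _ A'' (bondEquiv F K b))‖ < ε →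
        ((((eta F n K : ℝ) : ℂ)) * Complex.I) • (fun b : PBond (F.P K) 0 => JetSup.equiv _ _ _ (Tc A'') (bondEquiv F K b))
          = χ (((((eta F n K : ℝ) : ℂ)) * Complex.I) • fun b : PBond (F.P K) 0 => JetSup.equiv _ _ _ A'' (bondEquiv F K b)))
    (A₁ Z δ' : Space115 (F.L : ℝ) (((F.L : ℝ)⁻¹) ^ (K - n)) (fun _ : Bond 3 (periodsT3 F K) => K - n) (fun _ : Bond 3 (periodsT3 F K) × Fin 3 => K - n)
      (nabla115 (((F.L : ℝ)⁻¹) ^ (K - n)) (bgOfCfg F K U₀)))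
    (hA'C : ‖A₁ + Z‖ < aC) (hA' : ‖A₁ + Z‖ < ε')
    (hA : ‖((((eta F n K : ℝ) : ℂ)) * Complex.I) • ((fun b : PBond (F.P K) 0 => JetSup.equiv _ _ _ A₁ (bondEquiv F K b))
            + (fun b : PBond (F.P K) 0 => JetSup.equiv _ _ _ Z (bondEquiv F K b)))‖ < ε) :
    ∀ᶠ t : ℝ in 𝓝 0,
      ((((eta F n K : ℝ) : ℂ)) * Complex.I) • (fun b : PBond (F.P K) 0 => JetSup.equiv _ _ _ (Tc (A₁ + Z + (t : ℂ) • δ')) (bondEquiv F K b))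
        = χ (((((eta F n K : ℝ) : ℂ)) * Complex.I) • ((fun b : PBond (F.P K) 0 => JetSup.equiv _ _ _ A₁ (bondEquiv F K b))
                + (fun b : PBond (F.P K) 0 => JetSup.equiv _ _ _ Z (bondEquiv F K b)))
              + (t : ℂ) • (((((eta F n K : ℝ) : ℂ)) * Complex.I) • fun b : PBond (F.P K) 0 => JetSup.equiv _ _ _ δ' (bondEquiv F K b))) := by
  filter_upwards [eventually_windows U₀ A₁ Z δ' hA'C hA' hA] with t ht
  rw [hG _ ht.1 ht.2.1 ht.2.2, smul_iota_ray]

/-! ## §3 ★★ The instance of record today: (G22) made eventual along the ray -/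

/-- ★★ **`hchart` AT THE MEMBER, TODAY'S LETTERS**: (G22) ✓`Prop7SectET3WChartConj.smul_iota_T47_eq_chart` — chart `T47 H̃ C̃ εC` with `H̃ := H1f …Δ_π… U₀`,
`C̃ := fun A″ ↦ (−I) • CmapTwS U₀ (κ_f • ιA″)`, EX display chart `χ X := X − H46 U₀ (Dfix (CmapTwS U₀) (H46 U₀) C₂ X)` — under its displayed Sect. C ∕ B13 regime rows and windows, at a base point
`A₁ + Z` (the knit: `Z := H₁f B̃`) STRICTLY inside the radii, holds for all `t` near `0` along the ray `A₁ + Z + t•δ′`, in the literal shape of the assembly's `hchart` with `δ := κ_f • ιδ′`.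
[cite: Balaban1985Variational, (47)–(49) p.285, (55) p.286, (82)–(84) p.290, (112) p.294] -/
theorem eventually_smul_iota_T47_eq_chart {h : n ≤ K} {c₀ cB a : ℝ} [Fact (0 < c₀)] [Fact (0 < cB)]
    (U₀ : GaugeField (F.P K) 0 (Matrix.specialUnitaryGroup (Fin 2) ℂ)) {b C₂ᵣ c₄ aC εC C₂ R b₂ ε C₂' R' ε' : ℝ}
    (RC : Regime (H1f F n K h c₀ cB a (DeltaPiSlot F n K h c₀ cB a) U₀) 0
      (fun A' : Space115 (F.L : ℝ) (((F.L : ℝ)⁻¹) ^ (K - n)) (fun _ : Bond 3 (periodsT3 F K) => K - n)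
        (fun _ : Bond 3 (periodsT3 F K) × Fin 3 => K - n) (nabla115 (((F.L : ℝ)⁻¹) ^ (K - n)) (bgOfCfg F K U₀)) =>
          (-Complex.I) • CmapTwS F n K h U₀ (((((eta F n K : ℝ) : ℂ)) * Complex.I) • fun b : PBond (F.P K) 0 => JetSup.equiv _ _ _ A' (bondEquiv F K b)))
      b 0 C₂ᵣ c₄ 0 aC εC)
    (hC : QuadAnalytic (CmapTwS F n K h U₀) C₂ R) (hC₂ : 0 ≤ C₂) (hb₂ : 0 ≤ b₂) (hHop : ∀ X, ‖H46 F n K h c₀ cB a U₀ X‖ ≤ b₂ * ‖X‖)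
    (hq : 9 * C₂ * b₂ * ε < 1) (hRC : 3 * ε ≤ R)
    (hC' : QuadAnalytic (fun A' : Space115 (F.L : ℝ) (((F.L : ℝ)⁻¹) ^ (K - n)) (fun _ : Bond 3 (periodsT3 F K) => K - n)
        (fun _ : Bond 3 (periodsT3 F K) × Fin 3 => K - n) (nabla115 (((F.L : ℝ)⁻¹) ^ (K - n)) (bgOfCfg F K U₀)) =>
          (-Complex.I) • CmapTwS F n K h U₀ (((((eta F n K : ℝ) : ℂ)) * Complex.I) • fun b : PBond (F.P K) 0 => JetSup.equiv _ _ _ A' (bondEquiv F K b))) C₂' R')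
    (hC₂' : 0 ≤ C₂') (hq' : 9 * C₂' * b * ε' < 1) (hRC' : 3 * ε' ≤ R') (hwin : 4 * C₂' * b * ε' ^ 2 ≤ εC) (hnest : 4 * C₂' * ε' ^ 2 ≤ 4 * C₂ * ε ^ 2)
    (A₁ Z δ' : Space115 (F.L : ℝ) (((F.L : ℝ)⁻¹) ^ (K - n)) (fun _ : Bond 3 (periodsT3 F K) => K - n) (fun _ : Bond 3 (periodsT3 F K) × Fin 3 => K - n)
      (nabla115 (((F.L : ℝ)⁻¹) ^ (K - n)) (bgOfCfg F K U₀)))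
    (hA'C : ‖A₁ + Z‖ < aC) (hA' : ‖A₁ + Z‖ < ε')
    (hA : ‖((((eta F n K : ℝ) : ℂ)) * Complex.I) • ((fun b : PBond (F.P K) 0 => JetSup.equiv _ _ _ A₁ (bondEquiv F K b))
            + (fun b : PBond (F.P K) 0 => JetSup.equiv _ _ _ Z (bondEquiv F K b)))‖ < ε) :
    ∀ᶠ t : ℝ in 𝓝 0,
      ((((eta F n K : ℝ) : ℂ)) * Complex.I) • (fun b : PBond (F.P K) 0 => JetSup.equiv _ _ _
          (T47 (H1f F n K h c₀ cB a (DeltaPiSlot F n K h c₀ cB a) U₀)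
            (fun A' : Space115 (F.L : ℝ) (((F.L : ℝ)⁻¹) ^ (K - n)) (fun _ : Bond 3 (periodsT3 F K) => K - n)
              (fun _ : Bond 3 (periodsT3 F K) × Fin 3 => K - n) (nabla115 (((F.L : ℝ)⁻¹) ^ (K - n)) (bgOfCfg F K U₀)) =>
                (-Complex.I) • CmapTwS F n K h U₀ (((((eta F n K : ℝ) : ℂ)) * Complex.I) • fun b : PBond (F.P K) 0 => JetSup.equiv _ _ _ A' (bondEquiv F K b)))
            εC (A₁ + Z + (t : ℂ) • δ')) (bondEquiv F K b))
        = ((((eta F n K : ℝ) : ℂ)) * Complex.I) • ((fun b : PBond (F.P K) 0 => JetSup.equiv _ _ _ A₁ (bondEquiv F K b))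
                + (fun b : PBond (F.P K) 0 => JetSup.equiv _ _ _ Z (bondEquiv F K b)))
              + (t : ℂ) • (((((eta F n K : ℝ) : ℂ)) * Complex.I) • fun b : PBond (F.P K) 0 => JetSup.equiv _ _ _ δ' (bondEquiv F K b))
          - H46 F n K h c₀ cB a U₀ (Dfix (CmapTwS F n K h U₀) (H46 F n K h c₀ cB a U₀) C₂
              (((((eta F n K : ℝ) : ℂ)) * Complex.I) • ((fun b : PBond (F.P K) 0 => JetSup.equiv _ _ _ A₁ (bondEquiv F K b))
                + (fun b : PBond (F.P K) 0 => JetSup.equiv _ _ _ Z (bondEquiv F K b)))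
              + (t : ℂ) • (((((eta F n K : ℝ) : ℂ)) * Complex.I) • fun b : PBond (F.P K) 0 => JetSup.equiv _ _ _ δ' (bondEquiv F K b)))) :=
  eventually_chart_eq_of_pointwise U₀
    (χ := fun X : PBond (F.P K) 0 → Matrix (Fin 2) (Fin 2) ℂ => X - H46 F n K h c₀ cB a U₀ (Dfix (CmapTwS F n K h U₀) (H46 F n K h c₀ cB a U₀) C₂ X))
    (fun _ h1 h2 h3 => smul_iota_T47_eq_chart F n K h c₀ cB a U₀ RC hC hC₂ hb₂ hHop hq hRC hC' hC₂' hq' hRC' hwin hnest h1 h2 h3) A₁ Z δ' hA'C hA' hA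

end Summit.QuantumFields.YangMills.Theorems.Prop7ChartRayContinuity

end
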